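/-
Copyright: cell pub-balaban-gaps (YM BLITZ Y1, track G1), seat g1-p2 GEN 11 (unit `pub-balaban-gaps-g1-p2`).  Row (D4) NODE O, MODEL level:
the letters of `D4WalkBlockFormGradient` for 59b's fibred differences on the FINE TORUS `Site P 0 × F` — the Gram identity
`flatLap = Σ_μ (Df μ)ᴴ·Df μ` for `D4WalkBlockCovariantShift.flatLap` (`= η⁻²Σ_μ(2 − S_μ − S⁻_μ) ⊗ 1`), the conjugation-defect letter
`δ = η⁻¹(e^{|κ|ℓ} − 1)` of `Df μ = η⁻¹(S_μ − 1) ⊗ 1` and the transport letter `e^{2|κ|ℓ}` of `S⁻_μ ⊗ 1` for a weight `ρ` that moves by at most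
`ℓ` across a fine bond — hence gradient domination of 59b's `covDop` family (forward `Df μ`, backward-relabelled `S⁻_μ·Df μ`, index
`Fin d ⊕ Fin d`) by any flat operator `A₀` with `Re conjForm (A₀ − flatLap) ≥ −c′`: the `hD` hypothesis of `D4WalkBlockFormCoercive` on this
carrier.  At `ℓ = η` (a weight 1-Lipschitz in lattice units) `δ ≤ |κ|e^{|κ|η}`: NO `η⁻¹` — the k-UNIFORM reading (g1-plan-1 GEN 38 (υ)).
HONEST FRAMING: model-level linear algebra ([folklore]); the weight, `A₀` and `c′` are data; Bałaban's `Δ^{(k)}(𝐔)` NOT constructed; (D4)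
instance 0∕1; NOT BetaPertH, NOT continuum, NOT Clay.
-/
import Summits.QuantumFields.BalabanUV.Gaps.D4WalkBlockFormGradient
import Summits.QuantumFields.BalabanUV.Gaps.D4WalkBlockFormBaseTorus

/-!
# `Gaps.D4WalkBlockFormGradientTorus` — the Gram identity, the defect letter of `η⁻¹(S_μ − 1) ⊗ 1` and the transport letter of `S⁻_μ ⊗ 1` on the
# fine torus; gradient domination of 59b's `covDop` (cell pub-balaban-gaps, seat g1-p2 gen 11)

HONEST DEPENDENCY (cell pub-balaban, verbatim): continuum YM on T⁴ ⇐ BetaPertH ∧ nine spine estimates (0/9 proved); BetaPertH ⇐ (D1) ∧ (D4) ∧ CAP+tail.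

[B9] (3.23) p. 394 ∕ (3.42) p. 399 ∕ (3.52)–(3.54) pp. 400–401: the flat covariant Laplacian is `Σ_μ ∇_μ*∇_μ`; its conjugation by `e^{κρ}` moves
each `∇_μ = η⁻¹(S_μ − 1)` by `η⁻¹(e^{κ(ρ(x) − ρ(x+e_μ))} − 1)S_μ`, of size `κ` when `ρ` is Lipschitz in lattice units.  ON 59b's OBJECTS:
* §1 shifted-index algebra: `Sf_mulVec` ∕ `SBf_mulVec`, `conjMat_Sf_mulVec` ∕ `conjMat_SBf_mulVec`, `nsq_comp_shift` ∕ `nsq_comp_unshift`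
  (re-indexing by the translation, 63's `unshift_shift`), `nsq_smul`, `abs_exp_sub_one_le_of_abs_le`;
* §2 the letters: **`nsq_conjMat_Df_sub_le`** (`‖(conjMat (κ) (Df μ) − Df μ)z‖² ≤ (η⁻¹(e^{|κ|ℓ} − 1))²‖z‖²`, both signs of `κ` at once since
  only `|κ|` enters), **`nsq_conjMat_SBf_le`** (`‖conjMat κ (S⁻_μ ⊗ 1) y‖² ≤ e^{2|κ|ℓ}‖y‖²`), `inv_mul_exp_sub_one_le` (`η⁻¹(e^{aη} − 1) ≤ ae^{aη}`:
  the k-free reading at `ℓ = η`);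
* §3 the Gram identity: `Df_conjTranspose` (112's `Sf_conjTranspose` BY NAME), `Sf_mul_SBf`, **`flatLap_eq_gram`** (`flatLap = Σ_μ (Df μ)ᴴ·Df μ`;
  63's `Df_eq` BY NAME);
* §4 **`gradDom_covDop`**: `covDop = Sum.elim Df (S⁻·Df)` and, for `Re conjForm (A₀ − flatLap) z ≥ −c′‖z‖²`,
  `Σ_ι ‖conjMat κ (covDop ι) z‖² ≤ (1 + e^{2|κ|ℓ})·(2·Re conjForm A₀ z + (2c′ + 4d·δ²)‖z‖²)` — 110's `gradDom_of_gram` + `gradDom_sum_extend`.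
WHAT IT IS NOT.  The choice of `A₀` (63's `covOp` at the flat point: mass `≥ 0`, averaging term `Re`-nonnegative with its conjugation defect —
the `c′`), the base letter `h0` and the multiplier letters of `covShift` from 66's windows are NOT here; (D4) instance 0∕1; words of row (D4)
UNCHANGED (`ExistsUniformAcrossSmall 𝓣_Bałaban α Rσ₀ θ₀` + `TermDomination`, OBJECT level).

References (method only): T. Bałaban, Comm. Math. Phys. **99** (1985) 389–434 [B9], (3.23) p. 394, (3.42) p. 399, (3.52)–(3.54) pp. 400–401,
Cor. 3.6 p. 408; J.-M. Combes, L. Thomas, Comm. Math. Phys. **34** (1973) 251–270.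
-/

noncomputable section

namespace Summit.QuantumFields.BalabanUV.Gaps.D4WalkBlockFormGradientTorus

open Finset Complex Matrix
open scoped BigOperators Matrix ComplexConjugate
open Literature.MathematicalPhysics.QuantumFieldTheory.Balaban1983to89
open Literature.MathematicalPhysics.QuantumFieldTheory.Balaban1983to89.B5Prop11Lower (nsq nsq_nonneg)
open Summit.QuantumFields.BalabanUV.Beta.AccretiveCombesThomas (conjForm conjForm_add)
open Summit.QuantumFields.BalabanUV.T4Continuum.CTWeightedCoercivity (conjMat conjMat_apply conjMat_mul conjMat_sub conjMat_smul conjMat_one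
  conjForm_eq)
open Summit.QuantumFields.BalabanUV.Gaps.D4WalkBlockCovariantGeometry (SBf shift_unshift)
open Summit.QuantumFields.BalabanUV.Gaps.D4WalkBlockCovariantShift (Df Sf covDop flatLap SBf_mul_Sf)
open Summit.QuantumFields.BalabanUV.Gaps.D4WalkBlockCovariantPropagator (unshift_shift Df_eq)
open Summit.QuantumFields.BalabanUV.Gaps.D4WalkBlockFormBaseTorus (Sf_conjTranspose)
open Summit.QuantumFields.BalabanUV.Gaps.D4WalkBlockFormGradient (gradDom_of_gram gradDom_sum_extend)

variable {P : Params} {F : Type} [Fintype F] [DecidableEq F]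

/-! ## §1. Shifted-index algebra on `Site P 0 × F` -/

/-- `(S_μ ⊗ 1)z (x,a) = z(x + e_μ, a)`. -/
theorem Sf_mulVec (μ : Fin P.d) (z : Site P 0 × F → ℂ) (p : Site P 0 × F) : (Sf P F μ *ᵥ z) p = z (Site.shift p.1 μ, p.2) := by
  simp only [Matrix.mulVec, dotProduct, Sf, Matrix.of_apply, ite_mul, one_mul, zero_mul, Finset.sum_ite_eq', Finset.mem_univ, if_true]

/-- `(S⁻_μ ⊗ 1)z (x,a) = z(x − e_μ, a)`. -/
theorem SBf_mulVec (μ : Fin P.d) (z : Site P 0 × F → ℂ) (p : Site P 0 × F) : (SBf P F μ *ᵥ z) p = z (Site.unshift p.1 μ, p.2) := by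
  simp only [Matrix.mulVec, dotProduct, SBf, Matrix.of_apply, ite_mul, one_mul, zero_mul, Finset.sum_ite_eq', Finset.mem_univ, if_true]

/-- the conjugated forward shift: `(conjMat κ (S_μ ⊗ 1))z (p) = e^{κ(ρ p − ρ(p + e_μ))}·z(p + e_μ)`. -/
theorem conjMat_Sf_mulVec (κ : ℝ) (ρ : Site P 0 × F → ℝ) (μ : Fin P.d) (z : Site P 0 × F → ℂ) (p : Site P 0 × F) :
    (conjMat κ ρ ρ (Sf P F μ) *ᵥ z) p
      = ((Real.exp (κ * (ρ p - ρ (Site.shift p.1 μ, p.2))) : ℝ) : ℂ) * z (Site.shift p.1 μ, p.2) := by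
  simp only [Matrix.mulVec, dotProduct, conjMat_apply, Sf, Matrix.of_apply, mul_ite, mul_one, mul_zero, ite_mul, zero_mul,
    Finset.sum_ite_eq', Finset.mem_univ, if_true]

/-- the conjugated backward shift: `(conjMat κ (S⁻_μ ⊗ 1))z (p) = e^{κ(ρ p − ρ(p − e_μ))}·z(p − e_μ)`. -/
theorem conjMat_SBf_mulVec (κ : ℝ) (ρ : Site P 0 × F → ℝ) (μ : Fin P.d) (z : Site P 0 × F → ℂ) (p : Site P 0 × F) :
    (conjMat κ ρ ρ (SBf P F μ) *ᵥ z) p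
      = ((Real.exp (κ * (ρ p - ρ (Site.unshift p.1 μ, p.2))) : ℝ) : ℂ) * z (Site.unshift p.1 μ, p.2) := by
  simp only [Matrix.mulVec, dotProduct, conjMat_apply, SBf, Matrix.of_apply, mul_ite, mul_one, mul_zero, ite_mul, zero_mul,
    Finset.sum_ite_eq', Finset.mem_univ, if_true]

omit [DecidableEq F] in
/-- re-indexing by the forward translation does not change a weighted `ℓ²` mass. -/
theorem sum_comp_shift (μ : Fin P.d) (f : Site P 0 × F → ℝ) : ∑ p : Site P 0 × F, f (Site.shift p.1 μ, p.2) = ∑ p, f p :=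
  Fintype.sum_equiv ⟨fun p => (Site.shift p.1 μ, p.2), fun p => (Site.unshift p.1 μ, p.2),
    fun p => Prod.ext (unshift_shift P p.1 μ) rfl, fun p => Prod.ext (shift_unshift p.1 μ) rfl⟩ _ _ fun _ => rfl

omit [DecidableEq F] in
/-- re-indexing by the backward translation does not change a weighted `ℓ²` mass. -/
theorem sum_comp_unshift (μ : Fin P.d) (f : Site P 0 × F → ℝ) : ∑ p : Site P 0 × F, f (Site.unshift p.1 μ, p.2) = ∑ p, f p :=
  Fintype.sum_equiv ⟨fun p => (Site.unshift p.1 μ, p.2), fun p => (Site.shift p.1 μ, p.2),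
    fun p => Prod.ext (shift_unshift p.1 μ) rfl, fun p => Prod.ext (unshift_shift P p.1 μ) rfl⟩ _ _ fun _ => rfl

omit [DecidableEq F] in
/-- `‖c·v‖² = ‖c‖²‖v‖²`. -/
theorem nsq_smul (c : ℂ) (v : Site P 0 × F → ℂ) : nsq (c • v) = ‖c‖ ^ 2 * nsq v := by
  simp only [nsq, Pi.smul_apply, smul_eq_mul, norm_mul, mul_pow, Finset.mul_sum]

/-- `|e^s − 1| ≤ e^τ − 1` for `|s| ≤ τ`. -/
theorem abs_exp_sub_one_le_of_abs_le {s τ : ℝ} (h : |s| ≤ τ) : |Real.exp s - 1| ≤ Real.exp τ - 1 := by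
  rw [abs_le] at h ⊢
  have h1 : Real.exp s ≤ Real.exp τ := Real.exp_le_exp.mpr h.2
  have h2 : Real.exp (-τ) ≤ Real.exp s := Real.exp_le_exp.mpr h.1
  have h3 := Real.add_one_le_exp τ
  have h4 := Real.add_one_le_exp (-τ)
  constructor <;> linarith

/-! ## §2. The defect letter of `Df μ` and the transport letter of `S⁻_μ ⊗ 1` -/

/-- **THE DEFECT LETTER OF THE FORWARD DIFFERENCE**: if the weight moves by at most `ℓ` across every fine bond, then for every real `κ`
`‖(conjMat κ (Df μ) − Df μ)z‖² ≤ (η⁻¹(e^{|κ|ℓ} − 1))²·‖z‖²` — the diagonal of `Df` is untouched by the conjugation, the shift entry moves by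
`e^{κ(ρ p − ρ(p+e_μ))} − 1`. [folklore] [cite: Balaban1985BackgroundPropagators, (3.42) p.399, Cor. 3.6 p.408] -/
theorem nsq_conjMat_Df_sub_le (κ : ℝ) (ρ : Site P 0 × F → ℝ) {ℓ : ℝ} (hρ : ∀ (p : Site P 0 × F) (μ : Fin P.d), |ρ p - ρ (Site.shift p.1 μ, p.2)| ≤ ℓ)
    (μ : Fin P.d) (z : Site P 0 × F → ℂ) :
    nsq ((conjMat κ ρ ρ (Df P F μ) - Df P F μ) *ᵥ z) ≤ (P.eps⁻¹ * (Real.exp (|κ| * ℓ) - 1)) ^ 2 * nsq z := by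
  have hdef : conjMat κ ρ ρ (Df P F μ) - Df P F μ = (P.eps : ℂ)⁻¹ • (conjMat κ ρ ρ (Sf P F μ) - Sf P F μ) := by
    rw [Df_eq P F μ, conjMat_smul, conjMat_sub, conjMat_one κ ρ, ← smul_sub, sub_sub_sub_cancel_right]
  rw [hdef, Matrix.smul_mulVec, nsq_smul, norm_inv, Complex.norm_real, Real.norm_eq_abs, abs_of_pos P.eps_pos, mul_pow, mul_assoc]
  refine mul_le_mul_of_nonneg_left ?_ (by positivity)
  have hpt : ∀ p : Site P 0 × F, ‖((conjMat κ ρ ρ (Sf P F μ) - Sf P F μ) *ᵥ z) p‖ ^ 2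
      ≤ (Real.exp (|κ| * ℓ) - 1) ^ 2 * ‖z (Site.shift p.1 μ, p.2)‖ ^ 2 := by
    intro p
    rw [Matrix.sub_mulVec, Pi.sub_apply, conjMat_Sf_mulVec, Sf_mulVec, ← sub_one_mul, norm_mul, mul_pow, ← Complex.ofReal_one,
      ← Complex.ofReal_sub, Complex.norm_real, Real.norm_eq_abs]
    refine mul_le_mul_of_nonneg_right ?_ (sq_nonneg _)
    have hb : |κ * (ρ p - ρ (Site.shift p.1 μ, p.2))| ≤ |κ| * ℓ := by
      rw [abs_mul]; exact mul_le_mul_of_nonneg_left (hρ p μ) (abs_nonneg _)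
    have h0 : 0 ≤ |Real.exp (κ * (ρ p - ρ (Site.shift p.1 μ, p.2))) - 1| := abs_nonneg _
    exact pow_le_pow_left₀ h0 (abs_exp_sub_one_le_of_abs_le hb) 2
  calc nsq ((conjMat κ ρ ρ (Sf P F μ) - Sf P F μ) *ᵥ z)
      ≤ ∑ p : Site P 0 × F, (Real.exp (|κ| * ℓ) - 1) ^ 2 * ‖z (Site.shift p.1 μ, p.2)‖ ^ 2 := Finset.sum_le_sum fun p _ => hpt p
    _ = (Real.exp (|κ| * ℓ) - 1) ^ 2 * nsq z := by
        rw [← Finset.mul_sum, sum_comp_shift μ (fun p => ‖z p‖ ^ 2)]; rfl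

/-- **THE TRANSPORT LETTER OF THE BACKWARD SHIFT**: `‖conjMat κ (S⁻_μ ⊗ 1) y‖² ≤ e^{2|κ|ℓ}·‖y‖²`. [folklore] -/
theorem nsq_conjMat_SBf_le (κ : ℝ) (ρ : Site P 0 × F → ℝ) {ℓ : ℝ} (hρ : ∀ (p : Site P 0 × F) (μ : Fin P.d), |ρ p - ρ (Site.shift p.1 μ, p.2)| ≤ ℓ)
    (μ : Fin P.d) (y : Site P 0 × F → ℂ) : nsq (conjMat κ ρ ρ (SBf P F μ) *ᵥ y) ≤ Real.exp (2 * (|κ| * ℓ)) * nsq y := by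
  have hpt : ∀ p : Site P 0 × F, ‖(conjMat κ ρ ρ (SBf P F μ) *ᵥ y) p‖ ^ 2 ≤ Real.exp (2 * (|κ| * ℓ)) * ‖y (Site.unshift p.1 μ, p.2)‖ ^ 2 := by
    intro p
    rw [conjMat_SBf_mulVec, norm_mul, mul_pow, Complex.norm_real, Real.norm_eq_abs, abs_of_pos (Real.exp_pos _), ← Real.exp_nat_mul,
      Nat.cast_ofNat]
    refine mul_le_mul_of_nonneg_right (Real.exp_le_exp.mpr ?_) (sq_nonneg _)
    have hb : |κ * (ρ p - ρ (Site.unshift p.1 μ, p.2))| ≤ |κ| * ℓ := by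
      rw [abs_mul]
      refine mul_le_mul_of_nonneg_left ?_ (abs_nonneg _)
      have h := hρ (Site.unshift p.1 μ, p.2) μ
      rw [shift_unshift] at h
      rwa [abs_sub_comm] at h
    linarith [le_abs_self (κ * (ρ p - ρ (Site.unshift p.1 μ, p.2)))]
  calc nsq (conjMat κ ρ ρ (SBf P F μ) *ᵥ y) ≤ ∑ p : Site P 0 × F, Real.exp (2 * (|κ| * ℓ)) * ‖y (Site.unshift p.1 μ, p.2)‖ ^ 2 :=
        Finset.sum_le_sum fun p _ => hpt p
    _ = Real.exp (2 * (|κ| * ℓ)) * nsq y := by rw [← Finset.mul_sum, sum_comp_unshift μ (fun p => ‖y p‖ ^ 2)]; rfl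

/-- the k-FREE READING of the defect letter at `ℓ = η`: `η⁻¹(e^{aη} − 1) ≤ a·e^{aη}` for `η > 0` (any real `a`). [folklore] -/
theorem inv_mul_exp_sub_one_le (a : ℝ) {η : ℝ} (hη : 0 < η) : η⁻¹ * (Real.exp (a * η) - 1) ≤ a * Real.exp (a * η) := by
  have h1 := Real.add_one_le_exp (-(a * η))
  have h2 : Real.exp (-(a * η)) * Real.exp (a * η) = 1 := by rw [← Real.exp_add, neg_add_cancel, Real.exp_zero]
  have h3 : 0 < Real.exp (a * η) := Real.exp_pos _
  rw [inv_mul_le_iff₀ hη]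
  nlinarith [mul_le_mul_of_nonneg_right h1 h3.le]

/-! ## §3. The Gram identity `flatLap = Σ_μ (Df μ)ᴴ·Df μ` -/

omit [Fintype F] in
/-- `(Df μ)ᴴ = η⁻¹·(S⁻_μ ⊗ 1 − 1)`. -/
theorem Df_conjTranspose (μ : Fin P.d) : (Df P F μ)ᴴ = (P.eps : ℂ)⁻¹ • (SBf P F μ - 1) := by
  rw [Df_eq P F μ, Matrix.conjTranspose_smul, Matrix.conjTranspose_sub, Matrix.conjTranspose_one, Sf_conjTranspose, ← Complex.ofReal_inv,
    Complex.star_def, Complex.conj_ofReal]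

/-- `S_μS⁻_μ = 1` (with 59b's `S⁻_μS_μ = 1`: square matrices). -/
theorem Sf_mul_SBf (μ : Fin P.d) : Sf P F μ * SBf P F μ = 1 := mul_eq_one_comm.mp (SBf_mul_Sf μ)

/-- **THE GRAM IDENTITY**: `flatLap = Σ_μ (Df μ)ᴴ·Df μ` (`η⁻²(S⁻_μ − 1)(S_μ − 1) = η⁻²(2 − S_μ − S⁻_μ)`). [cite: Balaban1985BackgroundPropagators, (3.23) p.394] -/
theorem flatLap_eq_gram : flatLap P F = ∑ μ, (Df P F μ)ᴴ * Df P F μ := by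
  have hterm : ∀ μ : Fin P.d, (Df P F μ)ᴴ * Df P F μ
      = ((P.eps : ℂ)⁻¹) ^ 2 • ((2 : ℂ) • (1 : Matrix (Site P 0 × F) (Site P 0 × F) ℂ) - Sf P F μ - SBf P F μ) := by
    intro μ
    rw [Df_conjTranspose, Df_eq P F μ, Matrix.smul_mul, Matrix.mul_smul, smul_smul, ← pow_two, sub_mul, mul_sub,
      mul_sub, SBf_mul_Sf, Matrix.mul_one, Matrix.one_mul, Matrix.one_mul]
    congr 1
    rw [two_smul]
    abel
  rw [Finset.sum_congr rfl fun μ _ => hterm μ, ← Finset.smul_sum]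
  unfold flatLap
  rfl

/-! ## §4. Gradient domination of 59b's `covDop` on the fine torus -/

/-- 59b's family is `Sum.elim` of the forward differences and their backward relabellings. -/
theorem covDop_eq : covDop P F = Sum.elim (Df P F) (fun μ => SBf P F μ * Df P F μ) := by
  funext s; cases s <;> rfl

/-- **GRADIENT DOMINATION OF `covDop` ON THE FINE TORUS.**  For a weight moving by at most `ℓ ≥ 0` across every fine bond and any flat operator
`A₀` with `Re conjForm (A₀ − flatLap) z ≥ −c′‖z‖²`:
`Σ_ι ‖conjMat κ (covDop ι) z‖² ≤ (1 + e^{2|κ|ℓ})·2·Re conjForm A₀ z + (1 + e^{2|κ|ℓ})·(2c′ + 4d·(η⁻¹(e^{|κ|ℓ} − 1))²)·‖z‖²` — the `hD` hypothesis of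
`D4WalkBlockFormCoercive.conjCoercive_of_gradient` ∕ `gaugedCoercive_of_gradient` on this carrier with `γ = 2(1 + e^{2|κ|ℓ})`; at `ℓ = η` every
constant is bounded uniformly in the scale (`inv_mul_exp_sub_one_le`). [cite: Balaban1985BackgroundPropagators, (3.42) p.399, (3.52)–(3.54) pp.400–401, Cor. 3.6 p.408] -/
theorem gradDom_covDop (κ : ℝ) (ρ : Site P 0 × F → ℝ) {ℓ c' : ℝ} (hℓ : 0 ≤ ℓ)
    (hρ : ∀ (p : Site P 0 × F) (μ : Fin P.d), |ρ p - ρ (Site.shift p.1 μ, p.2)| ≤ ℓ) (A₀ : Matrix (Site P 0 × F) (Site P 0 × F) ℂ)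
    (hrest : ∀ z, -(c' * nsq z) ≤ (conjForm (A₀ - flatLap P F) κ ρ z).re) (z : Site P 0 × F → ℂ) :
    ∑ ι, nsq (conjMat κ ρ ρ (covDop P F ι) *ᵥ z)
      ≤ (1 + Real.exp (2 * (|κ| * ℓ))) * 2 * (conjForm A₀ κ ρ z).re
        + (1 + Real.exp (2 * (|κ| * ℓ))) * (2 * c' + 4 * P.d * (P.eps⁻¹ * (Real.exp (|κ| * ℓ) - 1)) ^ 2) * nsq z := by
  have hδ : 0 ≤ P.eps⁻¹ * (Real.exp (|κ| * ℓ) - 1) :=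
    mul_nonneg (inv_nonneg.mpr P.eps_pos.le) (by linarith [Real.add_one_le_exp (|κ| * ℓ), mul_nonneg (abs_nonneg κ) hℓ])
  have hrest' : ∀ w, -(c' * nsq w) ≤ (conjForm (A₀ - ∑ μ, (Df P F μ)ᴴ * Df P F μ) κ ρ w).re := by rw [← flatLap_eq_gram]; exact hrest
  have hgram := gradDom_of_gram A₀ (Df P F) κ ρ hδ (fun μ w => nsq_conjMat_Df_sub_le κ ρ hρ μ w)
    (fun μ w => by rw [← abs_neg κ]; exact nsq_conjMat_Df_sub_le (-κ) ρ hρ μ w) hrest'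
  have h := gradDom_sum_extend A₀ (Df P F) (SBf P F) κ ρ (Real.exp_pos (2 * (|κ| * ℓ))).le hgram
    (fun μ y => nsq_conjMat_SBf_le κ ρ hρ μ y) z
  rw [covDop_eq]
  simpa [Fintype.card_fin, mul_assoc, mul_comm, mul_left_comm] using h

end Summit.QuantumFields.BalabanUV.Gaps.D4WalkBlockFormGradientTorus

end
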